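import Summits.BirchSwinnertonDyer.Rank1Residual.X4.KimTamagawaDefect
import HarnessLib

/-!
# Line `kim-deficit` on crux `PrintX6.EisensteinHalfFiveLeRest` (stmt-BirchSwinnertonDyer-21116) — STUB 1
# `stub_levelCertificate_of_partialInfty_le`: a finite value of Kim's `∂^{(∞)}(δ̃)` is a LEVEL CERTIFICATE

Route `PrintX6`, crux `EisensteinHalfFiveLeRest` (rank 211), registered line `kim_deficit`
(`Cruxes/EisensteinHalfFiveLeRest/Lines/kim_deficit.lean`, sha16 `35e5095fac56ab01`, bsd-idea-8 g2;
director-bsd ROW 6 RULING (154)(b): stubs 1–2 only). This file proves the line's STUB 1 with its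
registered signature VERBATIM, from the tree's DEFINITIONS of Kim's numerical invariants
(`Literature/NumberTheory/EllipticCurves/KuriharaNumberInvariants.lean`: `kuriharaPartialInfty`,
`kuriharaPartial`, `kuriharaDivIndex`, `KuriharaDivisibleAt`, all valued in `ℕ∞`) — and from nothing
else: the `ℕ∞`-bookkeeping "a finite `∂^{(∞)}(δ̃) ≤ t` is attained at ONE cyclic Kolyvagin level and
unwinds to ONE non-zero Kurihara number of level `k ≤ t + 1`" is ALREADY a tree theorem,
`X4.exists_certificate_of_kuriharaPartialInfty_le` (`Rank1Residual/X4/KimTamagawaDefect.lean` §0, cell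
b2b-bsdres), which this file re-keys to the stub's binder order (nothing is restated).

Also recorded, by `Iff.rfl`: the per-pair conclusion of the line's HARD stub 3
(`kuriharaPartialInfty W p f ≤ ord_p ∏ c_ℓ`) IS the tree's typed conjecture item
`X4.KimTamagawaDefectLeAt W p f` (the `≤` half of Kim's Conjecture 1.10), so the existing per-pair
certificate API (`KuriharaRigidity.kimTamagawaDefectLeAt_iff_exists_certificate`,
`KuriharaRigidity.kuriharaPartialInfty_le_of_certificate`) applies to stub-3 instances verbatim.

HONEST FRAMING: bookkeeping about the tree's own definitions (C.-H. Kim, Amer. J. Math. 148 (2026)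
= arXiv:2203.12159, §1.5.1, Def. 2.13); no arithmetic input, no named fact; the crux stays OPEN and
BSD is not proved by any of this. Lands `--supports stmt-BirchSwinnertonDyer-21116` (line kim-deficit,
stub 1).
-/

set_option autoImplicit false
-- single-conjunct summit: the canonical namespace `Summit.BirchSwinnertonDyer.BirchSwinnertonDyer.…` repeats the name
set_option linter.dupNamespace false

noncomputable section

open scoped Classical MatrixGroups ModularForm

open CongruenceSubgroup WeierstrassCurve Literature.NumberTheory.EllipticCurves
  Literature.NumberTheory.EllipticCurves.ModularForms
  Summit.BirchSwinnertonDyer.Rank1Residual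

namespace Summit.BirchSwinnertonDyer.BirchSwinnertonDyer.Theorems.PrintX6.KimDeficit

/-- **STUB 1 of line `kim-deficit` (registered signature verbatim).** A finite value `∂^{(∞)}(δ̃) ≤ t`
of Kim's invariant is WITNESSED by one explicit certificate of level `k ≤ t + 1`: a cyclic Kolyvagin
level `n ∈ 𝒩_k(E,p)` (square-free product of Kolyvagin primes of level `k`, each with cyclic `p`-torsion
in the reduction, `#Ẽ(𝔽_ℓ)[p] ≤ p`), surjective discrete logarithms `ψ_ℓ : (ℤ/ℓ)ˣ ↠ ℤ/p^k` at `ℓ ∣ n`,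
and `δ̃_n^{(k)} = kuriharaNumber f (p^k) n ψ ≠ 0`; `k ≥ 1` because `ℤ/p^0 = 0`. Proof: the tree theorem
`X4.exists_certificate_of_kuriharaPartialInfty_le` (the infima over the index sets of `∂^{(i)}`,
`∂^{(∞)}` are attained in the complete linear order `ℕ∞`; `kuriharaDivIndex n ≤ t` is
`¬ KuriharaDivisibleAt n (t+1)`, unwound), re-keyed; the cyclicity clause is the second conjunct of
`IsCyclicKolyvaginLevel`. Definitions only. [cite: Kim2022StructureSelmer, §1.5.1 (PDF p. 7), Def. 2.13 (PDF p. 14)] -/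
theorem stub_levelCertificate_of_partialInfty_le :
    ∀ (W : WeierstrassCurve ℚ) [W.IsGloballyMinimal] (p : ℕ) [Fact p.Prime] {N : ℕ}
      (f : CuspForm (Gamma0 N) 2) (t : ℕ),
      kuriharaPartialInfty W p f ≤ (t : ℕ∞) →
      ∃ (k n : ℕ) (_ : NeZero n), 1 ≤ k ∧ k ≤ t + 1 ∧ Kato.IsKolyvaginProduct W p k n ∧
        (∀ (ℓ : ℕ) [Fact ℓ.Prime], ℓ ∣ n →
          Nat.card {P : ((WeierstrassCurve.integralModelInt W).map
              (Int.castRingHom (ZMod ℓ))).toAffine.Point // p • P = 0} ≤ p) ∧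
        ∃ ψ : (ℓ : ℕ) → (ZMod ℓ)ˣ →* Multiplicative (ZMod (p ^ k)),
          (∀ ℓ ∈ n.primeFactors, Function.Surjective (ψ ℓ)) ∧
            kuriharaNumber f (p ^ k) n ψ ≠ 0 := by
  intro W _ p _ N f t ht
  obtain ⟨n, k, hk, hcyc, hk1, hkt, ψ, hψ, hne⟩ :=
    X4.exists_certificate_of_kuriharaPartialInfty_le W p f ht
  exact ⟨k, n, ⟨hk.ne_zero⟩, hk1, hkt, hk, fun ℓ _ hℓ => hcyc.2 ℓ hℓ, ψ, hψ, hne⟩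

/-- **The hard stub's per-pair conclusion IS the typed conjecture item.** For every pair and cusp form,
`kuriharaPartialInfty W p f ≤ ord_p ∏ c_ℓ` (the conclusion of stub 3
`stub_partialInfty_le_tamagawa_X6Rest` at `(W, p, f)`) is DEFINITIONALLY the tree's
`X4.KimTamagawaDefectLeAt W p f` — the `≤` half of Kim's Conjecture 1.10 as typed in
`Rank1Residual/X4/KimTamagawaDefect.lean` — so a per-pair instance of stub 3 is decided by ONE
Kurihara number through `KuriharaRigidity.kimTamagawaDefectLeAt_iff_exists_certificate`.
[cite: Kim2022StructureSelmer, Conj. 1.10 (§1.5.3, PDF p. 8)] -/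
theorem partialInfty_le_tamagawa_iff_kimTamagawaDefectLeAt
    (W : WeierstrassCurve ℚ) [W.IsGloballyMinimal] (p : ℕ) {N : ℕ} (f : CuspForm (Gamma0 N) 2) :
    kuriharaPartialInfty W p f ≤ (padicValNat p W.tamagawaProduct : ℕ∞) ↔
      X4.KimTamagawaDefectLeAt W p f :=
  Iff.rfl

end Summit.BirchSwinnertonDyer.BirchSwinnertonDyer.Theorems.PrintX6.KimDeficit

end
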